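import Summits.Ventures.PercRepro.SixThreeStep5A

/-!
# PercRepro — Step 5 of Lemma PL (`g ≥ 41`), continuation `SixThreeStep5B` (p3 gen 8; split of the gen-7 module
`SixThreeStep5.lean` into five parts per the 400-line lint, proofs byte-identical, preambles only)

Parts II–III of the original module: `sumIcc` as a `Finset` sum, binomial sums, Vandermonde lower bounds; the counts
of the empty profile and of a single line, and their signs.  Continues in `SixThreeStep5C.lean`.
-/

namespace PercRepro.SixThree.Table

/-! ## Part II: sums — `sumIcc` as a `Finset` sum, binomial sums, Vandermonde lower bounds -/

/-- `sumIcc f lo n = Σ_{s ∈ Icc lo n} f s`. -/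
theorem sumIcc_eq_finset (f : ℕ → ℚ) (lo : ℕ) : ∀ n, sumIcc f lo n = ∑ s ∈ Finset.Icc lo n, f s
  | 0 => by
    simp only [sumIcc]
    split_ifs with h
    · subst h; simp
    · rw [Finset.Icc_eq_empty (by omega), Finset.sum_empty]
  | n + 1 => by
    simp only [sumIcc, sumIcc_eq_finset f lo n]
    split_ifs with h
    · rw [Finset.sum_Icc_succ_top h]
    · rw [Finset.Icc_eq_empty (by omega), Finset.Icc_eq_empty (by omega)]; simp

/-- `sumIcc` is monotone in the summand (only the values on `[lo, n]` matter). -/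
theorem sumIcc_le_sumIcc {f g : ℕ → ℚ} (lo : ℕ) (h : ∀ s, lo ≤ s → f s ≤ g s) :
    ∀ n, sumIcc f lo n ≤ sumIcc g lo n
  | 0 => by
    simp only [sumIcc]
    split_ifs with h0
    · exact h 0 (by omega)
    · exact le_rfl
  | n + 1 => by
    simp only [sumIcc]
    have ih := sumIcc_le_sumIcc lo h n
    split_ifs with h1
    · exact add_le_add ih (h (n + 1) h1)
    · simpa using ih

/-- Peeling the first term: `sumIcc f lo n = f lo + sumIcc f (lo + 1) n` for `lo ≤ n`. -/
theorem sumIcc_succ_left (f : ℕ → ℚ) {lo n : ℕ} (h : lo ≤ n) :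
    sumIcc f lo n = f lo + sumIcc f (lo + 1) n := by
  rw [sumIcc_eq_finset, sumIcc_eq_finset, ← Finset.Ico_add_one_right_eq_Icc, ← Finset.Ico_add_one_right_eq_Icc,
    Finset.sum_eq_sum_Ico_succ_bot (by omega)]

/-- Shifting the index of a sum over `Icc`: `Σ_{s ∈ Icc a b} f (s − k) = Σ_{r ∈ Icc (a−k) (b−k)} f r` for `k ≤ a ≤ b`. -/
theorem sum_Icc_shift (f : ℕ → ℚ) {a b k : ℕ} (hk : k ≤ a) (hab : a ≤ b) :
    ∑ s ∈ Finset.Icc a b, f (s - k) = ∑ r ∈ Finset.Icc (a - k) (b - k), f r := by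
  apply Finset.sum_nbij' (fun s => s - k) (fun r => r + k)
  · intro s hs; simp only [Finset.mem_Icc] at hs ⊢; omega
  · intro r hr; simp only [Finset.mem_Icc] at hr ⊢; omega
  · intro s hs; simp only [Finset.mem_Icc] at hs; omega
  · intro r _; simp
  · intro s _; rfl

/-- `Σ_{r < k} C(m, r) + Σ_{r ∈ Icc k n} C(m, r) = 2^m` whenever `k ≤ n + 1` and `m ≤ n`. -/
theorem sum_range_add_sum_Icc_choose (m : ℕ) {k n : ℕ} (hk : k ≤ n + 1) (hmn : m ≤ n) :
    ∑ r ∈ Finset.range k, m.choose r + ∑ r ∈ Finset.Icc k n, m.choose r = 2 ^ m := by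
  rw [← Finset.Ico_add_one_right_eq_Icc, Finset.sum_range_add_sum_Ico _ hk, ← Nat.sum_range_choose m,
    ← Finset.sum_range_add_sum_Ico _ (by omega : m + 1 ≤ n + 1)]
  have : ∑ r ∈ Finset.Ico (m + 1) (n + 1), m.choose r = 0 := by
    apply Finset.sum_eq_zero
    intro r hr
    rw [Finset.mem_Ico] at hr
    exact Nat.choose_eq_zero_of_lt (by omega)
  rw [this, add_zero]

/-- A partial binomial sum is at most `2^m`. -/
theorem sum_Icc_choose_le (m a b : ℕ) : ∑ r ∈ Finset.Icc a b, m.choose r ≤ 2 ^ m := by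
  calc ∑ r ∈ Finset.Icc a b, m.choose r = ∑ r ∈ (Finset.Icc a b).filter (fun r => r ≤ m), m.choose r := by
        symm
        apply Finset.sum_subset (Finset.filter_subset _ _)
        intro r hr hr'
        simp only [Finset.mem_filter, not_and, not_le] at hr'
        exact Nat.choose_eq_zero_of_lt (hr' hr)
    _ ≤ ∑ r ∈ Finset.range (m + 1), m.choose r := by
        apply Finset.sum_le_sum_of_subset_of_nonneg
        · intro r hr
          simp only [Finset.mem_filter] at hr
          exact Finset.mem_range.2 (by omega)
        · intros; exact Nat.zero_le _
    _ = 2 ^ m := Nat.sum_range_choose m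

/-- The same with a shifted index (`k ≤ a ≤ b`). -/
theorem sum_Icc_choose_sub_le (m : ℕ) {a b k : ℕ} (hk : k ≤ a) (hab : a ≤ b) :
    ∑ s ∈ Finset.Icc a b, m.choose (s - k) ≤ 2 ^ m := by
  have h := sum_Icc_shift (fun r => ((m.choose r : ℕ) : ℚ)) hk hab
  have h' : ((∑ s ∈ Finset.Icc a b, m.choose (s - k) : ℕ) : ℚ) =
      ((∑ r ∈ Finset.Icc (a - k) (b - k), m.choose r : ℕ) : ℚ) := by push_cast; exact h
  have h'' : ∑ s ∈ Finset.Icc a b, m.choose (s - k) = ∑ r ∈ Finset.Icc (a - k) (b - k), m.choose r := by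
    exact_mod_cast h'
  rw [h'']
  exact sum_Icc_choose_le m _ _

/-- Vandermonde, two terms: `C(m, k+1) + j·C(m, k) ≤ C(m + j, k + 1)`. -/
theorem vandermonde_two (m k : ℕ) : ∀ j : ℕ, m.choose (k + 1) + j * m.choose k ≤ (m + j).choose (k + 1)
  | 0 => by simp
  | j + 1 => by
    have ih := vandermonde_two m k j
    have h : m.choose k ≤ (m + j).choose k := Nat.choose_le_choose k (by omega)
    rw [show m + (j + 1) = (m + j) + 1 by ring, Nat.choose_succ_succ']
    nlinarith

/-- Vandermonde, three terms: `C(m, k+2) + j·C(m, k+1) + C(j,2)·C(m, k) ≤ C(m + j, k + 2)`. -/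
theorem vandermonde_three (m k : ℕ) :
    ∀ j : ℕ, m.choose (k + 2) + j * m.choose (k + 1) + j.choose 2 * m.choose k ≤ (m + j).choose (k + 2)
  | 0 => by simp
  | j + 1 => by
    have ih := vandermonde_three m k j
    have h2 := vandermonde_two m k j
    have e1 : (m + (j + 1)).choose (k + 2) = (m + j).choose (k + 1) + (m + j).choose (k + 2) := by
      rw [show m + (j + 1) = (m + j) + 1 by ring, Nat.choose_succ_succ']
    have e2 : (j + 1).choose 2 = j + j.choose 2 := by
      have := Nat.choose_succ_succ' j 1
      simpa [Nat.choose_one_right] using this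
    rw [e1, e2]
    nlinarith

/-- `C(m + j, k) ≥ C(m, k) + j·C(m, k − 1) + C(j, 2)·C(m, k − 2)` for `k ≥ 2`, in `ℚ`. -/
theorem vandermonde_three_cast (m j : ℕ) {k : ℕ} (hk : 2 ≤ k) :
    (m.choose k : ℚ) + j * m.choose (k - 1) + (j.choose 2 : ℕ) * m.choose (k - 2) ≤ ((m + j).choose k : ℚ) := by
  obtain ⟨k', rfl⟩ : ∃ k', k = k' + 2 := ⟨k - 2, by omega⟩
  have h := vandermonde_three m k' j
  rw [show k' + 2 - 1 = k' + 1 by omega, show k' + 2 - 2 = k' by omega]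
  exact_mod_cast h

/-- `C(m + j, k) ≥ C(m, k) + j·C(m, k − 1)` for `k ≥ 1`, in `ℚ`. -/
theorem vandermonde_two_cast (m j : ℕ) {k : ℕ} (hk : 1 ≤ k) :
    (m.choose k : ℚ) + j * m.choose (k - 1) ≤ ((m + j).choose k : ℚ) := by
  obtain ⟨k', rfl⟩ : ∃ k', k = k' + 1 := ⟨k - 1, by omega⟩
  have h := vandermonde_two m k' j
  rw [show k' + 1 - 1 = k' by omega]
  exact_mod_cast h


/-! ## Part III: the counts of the empty profile and of a single line, and their signs -/

/-- `S₂(m) = 1 + m + C(m,2)`, `S₃(m) = S₂(m) + C(m,3)`, `S₅(g) = Σ_{r<6} C(g,r)` — the polynomial corrections. -/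
def S2 (m : ℕ) : ℚ := 1 + m + (m.choose 2 : ℕ)
/-- `S₃(m) = 1 + m + C(m,2) + C(m,3)`. -/
def S3 (m : ℕ) : ℚ := 1 + m + (m.choose 2 : ℕ) + (m.choose 3 : ℕ)
/-- `S₅(g) = Σ_{r < 6} C(g, r)`. -/
def S5 (g : ℕ) : ℚ := ((∑ r ∈ Finset.range 6, g.choose r : ℕ) : ℚ)

/-- `Σ_{r<3} C(g,r) = S₂(g)` and `Σ_{r<4} C(g,r) = S₃(g)`. -/
theorem sum_range_three_choose (m : ℕ) : ((∑ r ∈ Finset.range 3, m.choose r : ℕ) : ℚ) = S2 m := by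
  simp only [Finset.sum_range_succ, Finset.sum_range_zero, Nat.choose_zero_right, Nat.choose_one_right, S2]
  push_cast; ring
/-- `Σ_{r<4} C(m,r) = S₃(m)`. -/
theorem sum_range_four_choose (m : ℕ) : ((∑ r ∈ Finset.range 4, m.choose r : ℕ) : ℚ) = S3 m := by
  simp only [Finset.sum_range_succ, Finset.sum_range_zero, Nat.choose_zero_right, Nat.choose_one_right, S3]
  push_cast; ring

/-- `Σ_{s ∈ Icc 3 g} C(g, s) = 2^g − S₂(g)`. -/
theorem sum_Icc_three_choose {g : ℕ} (hg : 2 ≤ g) : ((∑ s ∈ Finset.Icc 3 g, g.choose s : ℕ) : ℚ) = 2 ^ g - S2 g := by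
  have h := sum_range_add_sum_Icc_choose g (k := 3) (n := g) (by omega) le_rfl
  have h' : ((∑ r ∈ Finset.range 3, g.choose r : ℕ) : ℚ) + ((∑ s ∈ Finset.Icc 3 g, g.choose s : ℕ) : ℚ) = 2 ^ g := by
    exact_mod_cast h
  rw [sum_range_three_choose] at h'
  linarith

/-- `Σ_{s ∈ Icc 6 g} C(g, s) = 2^g − S₅(g)` for `g ≥ 5`. -/
theorem sum_Icc_six_choose {g : ℕ} (hg : 5 ≤ g) : ((∑ s ∈ Finset.Icc 6 g, g.choose s : ℕ) : ℚ) = 2 ^ g - S5 g := by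
  have h := sum_range_add_sum_Icc_choose g (k := 6) (n := g) (by omega) le_rfl
  have h' : ((∑ r ∈ Finset.range 6, g.choose r : ℕ) : ℚ) + ((∑ s ∈ Finset.Icc 6 g, g.choose s : ℕ) : ℚ) = 2 ^ g := by
    exact_mod_cast h
  unfold S5
  linarith

/-- `Σ_{r ∈ Icc 4 n} C(m, r) = 2^m − S₃(m)` for `m ≤ n`, `n ≥ 3`. -/
theorem sum_Icc_four_choose {m n : ℕ} (hmn : m ≤ n) (hn : 3 ≤ n) :
    ((∑ r ∈ Finset.Icc 4 n, m.choose r : ℕ) : ℚ) = 2 ^ m - S3 m := by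
  have h := sum_range_add_sum_Icc_choose m (k := 4) (n := n) (by omega) hmn
  have h' : ((∑ r ∈ Finset.range 4, m.choose r : ℕ) : ℚ) + ((∑ r ∈ Finset.Icc 4 n, m.choose r : ℕ) : ℚ) = 2 ^ m := by
    exact_mod_cast h
  rw [sum_range_four_choose] at h'
  linarith

/-- `N₃(g, []) = 2^g − S₂(g)`. -/
theorem N3cnt_nil {g : ℕ} (hg : 2 ≤ g) : N3cnt g [] = 2 ^ g - S2 g := by
  simp only [N3cnt, List.map_nil, List.sum_nil, sub_zero]
  rw [sumIcc_eq_finset]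
  have := sum_Icc_three_choose hg
  push_cast at this
  simp only [ch_eq_choose]
  exact this

/-- `N₃(g, [m]) = 2^g − S₂(g) − E(m)`, `E(m) = 2^m − S₂(m)`. -/
theorem N3cnt_single {g : ℕ} (hg : 2 ≤ g) (m : ℕ) : N3cnt g [m] = 2 ^ g - S2 g - (2 ^ m - S2 m) := by
  simp only [N3cnt, List.map_cons, List.map_nil, List.sum_cons, List.sum_nil, add_zero]
  rw [sumIcc_eq_finset]
  have := sum_Icc_three_choose hg
  push_cast at this
  simp only [ch_eq_choose, S2]
  rw [this]; simp only [S2]; ring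

/-- `C₂(g, []) = S₂(g)`. -/
theorem C2_nil (g : ℕ) : C2 g [] = S2 g := by
  simp [C2, S2, ch_eq_choose]

/-- `C₂(g, [m]) = S₂(g) + (2^m − m − 1) − C(m, 2)`. -/
theorem C2_single (g m : ℕ) : C2 g [m] = S2 g + (2 ^ m - m - 1) - (m.choose 2 : ℕ) := by
  simp [C2, S2, ch_eq_choose]; ring

/-- The demand of the empty profile is at most `3·2^g`. -/
theorem D_nil_le {t g : ℕ} (ht : t = 1 ∨ t = 2 ∨ t = 3) (hg : 2 ≤ g) : D t g [] ≤ 3 * 2 ^ g := by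
  have hN := N3cnt_nil hg
  have hC := C2_nil g
  have hS : 0 ≤ S2 g := by unfold S2; positivity
  rcases ht with rfl | rfl | rfl <;> simp only [D] <;> rw [hN] <;> try rw [hC]
  · linarith
  · have : (0 : ℚ) ≤ g := by positivity
    linarith
  · linarith

/-- The demand of one line: `D_t(g, [m]) ≤ 3·(2^g − E(m)) − 3·[t = 3]·(2^m − m − 1)` for `m ≤ g`. -/
theorem D_single_le {t g m : ℕ} (ht : t = 1 ∨ t = 2 ∨ t = 3) (hg : 2 ≤ g) (hm : m ≤ g) :
    D t g [m] ≤ 3 * (2 ^ g - (2 ^ m - S2 m)) - (if t = 3 then 3 else 0) * (2 ^ m - m - 1) := by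
  have hN := N3cnt_single hg m
  have hC := C2_single g m
  have hS : 0 ≤ S2 g := by unfold S2; positivity
  have hc : (m.choose 2 : ℚ) ≤ (g.choose 2 : ℚ) := by exact_mod_cast Nat.choose_le_choose 2 hm
  have hg0 : (0 : ℚ) ≤ g := by positivity
  rcases ht with rfl | rfl | rfl <;> simp only [D] <;> rw [hN] <;> try rw [hC]
  · simp; linarith
  · simp; linarith
  · simp only [S2] at *; simp; linarith

/-- The counts of the empty profile. -/
theorem Tcnt_nil (g : ℕ) : Tcnt g [] = (g.choose 3 : ℕ) := by simp [Tcnt, ch_eq_choose]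
/-- `N₄^c(g, []) = 0`. -/
theorem N4c_nil (g : ℕ) : N4c g [] = 0 := by simp [N4c]
/-- `N₄^g(g, []) ≥ 0`. -/
theorem N4g_nil_nonneg (g : ℕ) : 0 ≤ N4g g [] := by
  simp only [N4g, Tcnt_nil, N4c_nil, mul_zero, sub_zero]; positivity

/-- The summand of the empty profile: `C(g,s)·v^{rest}(s)` for `s ≥ 6`, `C(g,5)·v^{s−2}(5)` at `s = 5`. -/
theorem summand_nil (t g s : ℕ) : summand t g [] s =
    (if 6 ≤ s then (g.choose s : ℚ) * vRest t s else (g.choose s : ℚ) * vNon t s) := by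
  simp only [summand, lps, ds, rests, Ns, List.map_nil, List.sum_nil, sub_zero, zero_mul, zero_add, ch_eq_choose]
  split_ifs <;> ring

/-- The summand of the empty profile is at least `r₆·C(g, s)` for `s ≥ 6` and `≥ 0` otherwise. -/
theorem summand_nil_ge {t g : ℕ} (ht : t = 1 ∨ t = 2 ∨ t = 3) (s : ℕ) :
    (if 6 ≤ s then (g.choose s : ℚ) * r6 t else 0) ≤ summand t g [] s := by
  rw [summand_nil]
  split_ifs with h6
  · exact mul_le_mul_of_nonneg_left (vRest_ge ht h6) (Nat.cast_nonneg _)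
  · exact mul_nonneg (Nat.cast_nonneg _) (vNon_nonneg ht s)

/-- `F_t(g, []) ≥ r₆·(2^g − S₅(g))` for `g ≥ 5`. -/
theorem F_nil_ge {t g : ℕ} (ht : t = 1 ∨ t = 2 ∨ t = 3) (hg : 5 ≤ g) :
    r6 t * (2 ^ g - S5 g) ≤ F t g [] := by
  have e : F t g [] = Tcnt g [] * vTriple t + N4g g [] * vGen4 t + N4c g [] * vCol4 t +
      sumIcc (summand t g []) 5 g := rfl
  rw [e, Tcnt_nil, N4c_nil]
  have h1 : 0 ≤ (g.choose 3 : ℚ) * vTriple t := mul_nonneg (by positivity) (vTriple_nonneg ht)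
  have h2 : 0 ≤ N4g g [] * vGen4 t := mul_nonneg (N4g_nil_nonneg g) (vGen4_nonneg ht)
  have h3 : sumIcc (fun s => if 6 ≤ s then (g.choose s : ℚ) * r6 t else 0) 5 g ≤ sumIcc (summand t g []) 5 g :=
    sumIcc_le_sumIcc 5 (fun s _ => summand_nil_ge ht s) g
  have h4 : sumIcc (fun s => if 6 ≤ s then (g.choose s : ℚ) * r6 t else 0) 5 g = r6 t * (2 ^ g - S5 g) := by
    rw [sumIcc_succ_left _ hg, sumIcc_eq_finset]
    simp only [show ¬ (6 ≤ 5) by norm_num, if_false, zero_add]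
    rw [Finset.sum_congr rfl (fun s hs => by
      rw [if_pos (Finset.mem_Icc.1 hs).1] : ∀ s ∈ Finset.Icc 6 g, (if 6 ≤ s then (g.choose s : ℚ) * r6 t else 0) =
        (g.choose s : ℚ) * r6 t)]
    rw [← Finset.sum_mul, mul_comm]
    congr 1
    have := sum_Icc_six_choose hg
    push_cast at this
    exact this
  linarith

/-- `A_t(g) ≥ r₆·(2^g − S₅(g)) − 3·2^g` for `g ≥ 5`. -/
theorem A_ge {t g : ℕ} (ht : t = 1 ∨ t = 2 ∨ t = 3) (hg : 5 ≤ g) :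
    r6 t * (2 ^ g - S5 g) - 3 * 2 ^ g ≤ A t g := by
  have h1 := F_nil_ge ht hg
  have h2 := D_nil_le (g := g) ht (by omega)
  simp only [A, Δ]
  linarith


end PercRepro.SixThree.Table
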